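import Summits.QuantumFields.YangMills.Theorems.UnitScaleTiltFluctuationComparisonRegPrAnsatzT1DIdentities
import Summits.QuantumFields.YangMills.Theorems.UnitScaleTiltFluctuationComparisonRegPrAnsatzSRowBound

/-!
# Route `UnitScaleTilt` — crux K1bR-pr `FluctuationComparisonRegPrL` (stmt-QuantumFields-19935, ex 19201), stub `stub_oneStepSmallLift`
# (W7 line), (L1)-table for the INTERIOR (all-`L`) pipeline: «ANSATZ T» part 2 — THE TENSOR-LIFT TABLE `kzT` IN TREE COORDINATES,
# its row mass, and SLICE NEUTRALITY (support file `--supports stmt-QuantumFields-19935`)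

Cell `ym3-torus` (rung R3), seat `ym3-torus-p2` gen 10 (IR-NODE §16; parts 1a/1b `…AnsatzT1D{,Identities}`).

THE TABLE (`d = 3`, `R = 1`, block size `L = 2h+1`; fleet format of `ApproxLift.FaceSupported/SNeutral/RowMass/RowBound`): on a fine bond of
direction `a` at in-block offsets `p`, the coefficient of the coarse plaquette of orientation `o` at relative coarse position `j = kvec k`
is a PRODUCT of three 1-D kernels, one per direction (IR-NODE §16.2, `Z′ = H₁`):
`(Z′c)₀ = −(P¹⊗h⊗J⁰)c₀₁ − (P¹⊗P⁰⊗h)c₀₂`, `(Z′c)₁ = (h⊗J¹⊗J⁰)c₀₁ − (P⁰⊗P¹⊗h)c₁₂`, `(Z′c)₂ = (h⊗J⁰⊗J¹)c₀₂ + (P⁰⊗h⊗J¹)c₁₂`.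
It is INTERIOR-supported (directions 1, 2 use the tent/homotopy on interior bonds): no `FaceSupported`, the accuracy clause of the lift comes
from the Γ-leg layer (p1 g11 `…LiftLegs*`) through neutrality instead.

* §1 `tabT`/`kzT`, entry bound `|kzT| ≤ 2`, **`rowMass_T : RowMass 1 (kzT L) 162`**;
* §2 **SLICE NEUTRALITY** `SliceNeutral`: for every bond direction `a`, orientation `o`, displacement `k` and EVERY `a`-offset `q`,
  `Σ_r kzT a (r[a ↦ q]) o k = 0` (every term carries the homotopy `h` in a slot transverse to `a`, and `Σ_p h(p, ·) = 0`);
  in particular `SNeutral 1 (kzT L)` (`q = L−1`), and every line/contour sum weighted by the `a`-offset only vanishes.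

Part 3 (`…AnsatzTRowBound`) proves `RowBound n 1 (kzT L) (18/L²) 1` from the chain identities.  Elementary; nothing of Bałaban's is asserted.
-/

noncomputable section

open scoped BigOperators

namespace Summit.QuantumFields.YangMills.Theorems.ApproxLift.AnsatzT

open Literature.MathematicalPhysics.QuantumFieldTheory.Balaban1983to89
open Literature.MathematicalPhysics.QuantumFieldTheory.Balaban1983to89.T3ContinuumYM3Torus
open T4Continuum BlockAveraging
open AnsatzS (P3 o01 o02 o12 sum_orient3 univ_orient3)

/-! ## §1 The table and its row mass -/

/-- The product entry for bond direction `a`, orientation `(μ, ν)`, offsets `p`, relative coarse indices `j` (`h = (L−1)/2`). -/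
def tabT (h : ℕ) (a μ ν : ℕ) (p₀ p₁ p₂ : ℕ) (j₀ j₁ j₂ : ℤ) : ℝ :=
  if a = 0 ∧ μ = 0 ∧ ν = 1 then -(P1 h p₀ j₀ * hh h p₁ j₁ * J0 h p₂ j₂)
  else if a = 0 ∧ μ = 0 ∧ ν = 2 then -(P1 h p₀ j₀ * P0 h p₁ j₁ * hh h p₂ j₂)
  else if a = 1 ∧ μ = 0 ∧ ν = 1 then hh h p₀ j₀ * J1 h p₁ j₁ * J0 h p₂ j₂
  else if a = 1 ∧ μ = 1 ∧ ν = 2 then -(P0 h p₀ j₀ * P1 h p₁ j₁ * hh h p₂ j₂)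
  else if a = 2 ∧ μ = 0 ∧ ν = 2 then hh h p₀ j₀ * J0 h p₁ j₁ * J1 h p₂ j₂
  else if a = 2 ∧ μ = 1 ∧ ν = 2 then P0 h p₀ j₀ * hh h p₁ j₁ * J1 h p₂ j₂
  else 0

/-- **ANSATZ T** — the tensor-lift table in the fleet format (`d = 3`, `R = 1`, block size `L`, `h = L/2`). -/
def kzT (L : ℕ) : Fin 3 → (Fin 3 → Fin L) → Orient 3 → (Fin 3 → Fin (2 * 1 + 1)) → ℝ :=
  fun a p o k => tabT (L / 2) a o.1.1 o.1.2 (p 0) (p 1) (p 2) (((k 0 : ℕ) : ℤ) - 1) (((k 1 : ℕ) : ℤ) - 1) (((k 2 : ℕ) : ℤ) - 1)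

section EntryBounds

variable {h p : ℕ}

/-- `|P⁰(p, j)| ≤ 1`. -/
theorem abs_P0_le (h p : ℕ) (j : ℤ) : |P0 h p j| ≤ 1 :=
  (abs_P0 h p j).trans (by split_ifs <;> norm_num)
/-- `|P¹(p, j)| ≤ 1`. -/
theorem abs_P1_le (h p : ℕ) (j : ℤ) : |P1 h p j| ≤ 1 :=
  (abs_P1 h p j).trans (by split_ifs <;> norm_num)

/-- `|h(p, j)| ≤ 1` (`p ≤ 2h`). -/
theorem abs_hh_le (hp : p ≤ 2 * h) (j : ℤ) : |hh h p j| ≤ 1 := by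
  have hb := abs_hh (h := h) hp
  unfold hh mk3; split_ifs
  · linarith [abs_nonneg (hz h p)]
  · linarith [abs_nonneg (hm h p)]
  · simp
  · simp

/-- `|J⁰(p, j)| ≤ 2` (`p ≤ 2h`). -/
theorem abs_J0_le (hp : p ≤ 2 * h) (j : ℤ) : |J0 h p j| ≤ 2 := by
  have hb := abs_J0 (h := h) hp
  unfold J0 mk3; split_ifs
  · linarith [abs_nonneg (J0z h p), abs_nonneg (J0p h p)]
  · linarith [abs_nonneg (J0m h p), abs_nonneg (J0p h p)]
  · linarith [abs_nonneg (J0m h p), abs_nonneg (J0z h p)]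
  · simp

/-- `|J¹(p, j)| ≤ 1` (`h ≥ 1`, so `3/L ≤ 1`). -/
theorem abs_J1_le (h1 : 1 ≤ h) (p : ℕ) (j : ℤ) : |J1 h p j| ≤ 1 := by
  have hb := abs_J1 (h := h) p
  have hL : 3 / Lr h ≤ 1 := by
    rw [div_le_one (Lr_pos h)]; unfold Lr; have : (1:ℝ) ≤ h := by exact_mod_cast h1
    linarith
  unfold J1 mk3; split_ifs
  · linarith [abs_nonneg (J1z h p), abs_nonneg (J1p h p)]
  · linarith [abs_nonneg (J1m h p), abs_nonneg (J1p h p)]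
  · linarith [abs_nonneg (J1m h p), abs_nonneg (J1z h p)]
  · simp

/-- **ENTRY BOUND** `|tabT| ≤ 2` (`h ≥ 1`, offsets `≤ 2h`). -/
theorem abs_tabT_le (h1 : 1 ≤ h) {p₀ p₁ p₂ : ℕ} (hp₀ : p₀ ≤ 2 * h) (hp₁ : p₁ ≤ 2 * h) (hp₂ : p₂ ≤ 2 * h) (a μ ν : ℕ)
    (j₀ j₁ j₂ : ℤ) : |tabT h a μ ν p₀ p₁ p₂ j₀ j₁ j₂| ≤ 2 := by
  have abs_mul3_le : ∀ {x y z a b c : ℝ}, |x| ≤ a → |y| ≤ b → |z| ≤ c → |x * y * z| ≤ a * b * c := by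
    intro x y z a b c hx hy hz'
    rw [abs_mul, abs_mul]
    have ha : 0 ≤ a := (abs_nonneg _).trans hx
    have hb : 0 ≤ b := (abs_nonneg _).trans hy
    exact mul_le_mul (mul_le_mul hx hy (abs_nonneg _) ha) hz' (abs_nonneg _) (mul_nonneg ha hb)
  unfold tabT
  split_ifs
  · rw [abs_neg]; exact (abs_mul3_le (abs_P1_le h p₀ j₀) (abs_hh_le hp₁ j₁) (abs_J0_le hp₂ j₂)).trans (by norm_num)
  · rw [abs_neg]; exact (abs_mul3_le (abs_P1_le h p₀ j₀) (abs_P0_le h p₁ j₁) (abs_hh_le hp₂ j₂)).trans (by norm_num)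
  · exact (abs_mul3_le (abs_hh_le hp₀ j₀) (abs_J1_le h1 p₁ j₁) (abs_J0_le hp₂ j₂)).trans (by norm_num)
  · rw [abs_neg]; exact (abs_mul3_le (abs_P0_le h p₀ j₀) (abs_P1_le h p₁ j₁) (abs_hh_le hp₂ j₂)).trans (by norm_num)
  · exact (abs_mul3_le (abs_hh_le hp₀ j₀) (abs_J0_le hp₁ j₁) (abs_J1_le h1 p₂ j₂)).trans (by norm_num)
  · exact (abs_mul3_le (abs_P0_le h p₀ j₀) (abs_hh_le hp₁ j₁) (abs_J1_le h1 p₂ j₂)).trans (by norm_num)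
  · simp

end EntryBounds

section Table

variable {L m K : ℕ} {hL : Odd L ∧ 1 < L}

/-- An offset is `≤ 2h`. -/
theorem val_le_two_mul_half (hodd : Odd L) (q : Fin L) : (q : ℕ) ≤ 2 * (L / 2) := by
  have := q.isLt; obtain ⟨t, ht⟩ := hodd; omega

/-- **`|kzT| ≤ 2`** (odd `L ≥ 3`). -/
theorem abs_kzT_le (hodd : Odd L) (h3 : 3 ≤ L) (a : Fin 3) (p : Fin 3 → Fin L) (o : Orient 3) (k : Fin 3 → Fin (2 * 1 + 1)) :
    |kzT L a p o k| ≤ 2 :=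
  abs_tabT_le (by omega) (val_le_two_mul_half hodd _) (val_le_two_mul_half hodd _) (val_le_two_mul_half hodd _) _ _ _ _ _ _

/-- **ROW MASS** `K₁ = 162 = 2·27·3` (crude: `|entry| ≤ 2`, `27` displacements, `3` orientations). -/
theorem rowMass_T (hodd : Odd L) (h3 : 3 ≤ L) : RowMass (P := P3 L m K hL) 1 (kzT L) 162 := by
  intro a p
  calc ∑ o : Orient 3, ∑ k : Fin 3 → Fin (2 * 1 + 1), |kzT L a p o k|
      ≤ ∑ _o : Orient 3, ∑ _k : Fin 3 → Fin (2 * 1 + 1), (2 : ℝ) :=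
        Finset.sum_le_sum fun o _ => Finset.sum_le_sum fun k _ => abs_kzT_le hodd h3 a p o k
    _ = 162 := by
        simp only [Finset.sum_const, Finset.card_univ, Fintype.card_fun, Fintype.card_fin]
        rw [show Fintype.card (Orient 3) = 3 by rw [← Finset.card_univ, univ_orient3]; decide]
        norm_num

end Table

/-! ## §2 Slice neutrality -/

section Neutral

variable {L m K : ℕ} {hL : Odd L ∧ 1 < L}

/-- **SLICE NEUTRALITY** (hypothesis schema, generalising `SNeutral` from the exit slice to EVERY slice): for every bond direction `a`,
orientation `o`, displacement `k` and `a`-offset `q`, the table summed over all bonds of direction `a` in the slice `{p_a = q}` of a block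
vanishes (each bond of the slice is met `L` times by `r ↦ r[a ↦ q]`). -/
def SliceNeutral {P : Params} (R : ℕ) (kz : Fin P.d → (Fin P.d → Fin P.L) → Orient P.d → (Fin P.d → Fin (2 * R + 1)) → ℝ) : Prop :=
  ∀ a o k (q : Fin P.L), ∑ r : Fin P.d → Fin P.L, kz a (Function.update r a q) o k = 0

/-- Slice neutrality at the exit slice is S-neutrality. -/
theorem sNeutral_of_sliceNeutral {P : Params} {R : ℕ}
    {kz : Fin P.d → (Fin P.d → Fin P.L) → Orient P.d → (Fin P.d → Fin (2 * R + 1)) → ℝ} (h : SliceNeutral R kz) :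
    SNeutral R kz := fun a o k => h a o k (lastPos P)

/-- `Σ_{q < L} h(q, j) = 0` on `Fin L` for odd `L`. -/
theorem sum_hh_fin (hodd : Odd L) (j : ℤ) : ∑ q : Fin L, hh (L / 2) q j = 0 := by
  obtain ⟨t, rfl⟩ := hodd
  rw [show (2 * t + 1) / 2 = t by omega, Fin.sum_univ_eq_sum_range (fun q => hh t q j)]
  exact sum_hh t j

/-- A sum over all offset vectors of `f(r t) · g(r)`, with `g` independent of `r t` and `Σ f = 0`, vanishes. -/
theorem sum_eq_zero_of_factor (t : Fin 3) (v₀ : Fin L) (f : Fin L → ℝ) (hf : ∑ v, f v = 0) (g : (Fin 3 → Fin L) → ℝ)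
    (hg : ∀ r v, g (Function.update r t v) = g r) : ∑ r : Fin 3 → Fin L, f (r t) * g r = 0 := by
  set e := Equiv.funSplitAt t (Fin L) with he
  rw [Fintype.sum_equiv e (fun r => f (r t) * g r) (fun vs => f vs.1 * g (e.symm vs))
    (fun r => by show f (r t) * g r = f (e r).1 * g (e.symm (e r)); rw [Equiv.symm_apply_apply]; rfl)]
  rw [Fintype.sum_prod_type, Finset.sum_comm]
  refine Finset.sum_eq_zero fun s _ => ?_
  have hs : ∀ v, g (e.symm (v, s)) = g (e.symm (v₀, s)) := fun v => by
    have h1 : e.symm (v, s) = Function.update (e.symm (v₀, s)) t v := by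
      funext i
      by_cases hi : i = t
      · subst hi; simp [e, Equiv.funSplitAt, Equiv.piSplitAt]
      · simp [e, Equiv.funSplitAt, Equiv.piSplitAt, hi]
    rw [h1, hg]
  simp_rw [hs]
  rw [← Finset.sum_mul, hf, zero_mul]

/-- **ANSATZ T IS SLICE-NEUTRAL** (odd `L`): the homotopy factor sits in a slot transverse to the bond direction. -/
theorem sliceNeutral_T (hodd : Odd L) : SliceNeutral (P := P3 L m K hL) 1 (kzT L) := by
  intro a o k q
  obtain ⟨⟨μ, ν⟩, hμν⟩ := o
  have hn := fun j => sum_hh_fin (L := L) hodd j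
  -- enumerate the bond direction and the orientation: 9 cases, 3 of them trivially zero (`a ∉ o`)
  fin_cases a <;> obtain ⟨rfl, rfl⟩ | ⟨rfl, rfl⟩ | ⟨rfl, rfl⟩ := AnsatzS.orient_cases μ ν hμν
  · exact (Finset.sum_congr rfl fun r _ => by simp [kzT, tabT]; ring).trans
      (sum_eq_zero_of_factor 1 q (fun v => hh (L / 2) v (((k 1 : ℕ) : ℤ) - 1)) (hn _)
        (fun r => -(P1 (L / 2) q (((k 0 : ℕ) : ℤ) - 1) * J0 (L / 2) (r 2) (((k 2 : ℕ) : ℤ) - 1))) (fun r v => by simp))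
  · exact (Finset.sum_congr rfl fun r _ => by simp [kzT, tabT]; ring).trans
      (sum_eq_zero_of_factor 2 q (fun v => hh (L / 2) v (((k 2 : ℕ) : ℤ) - 1)) (hn _)
        (fun r => -(P1 (L / 2) q (((k 0 : ℕ) : ℤ) - 1) * P0 (L / 2) (r 1) (((k 1 : ℕ) : ℤ) - 1))) (fun r v => by simp))
  · simp [kzT, tabT]
  · exact (Finset.sum_congr rfl fun r _ => by simp [kzT, tabT]; ring).trans
      (sum_eq_zero_of_factor 0 q (fun v => hh (L / 2) v (((k 0 : ℕ) : ℤ) - 1)) (hn _)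
        (fun r => J1 (L / 2) q (((k 1 : ℕ) : ℤ) - 1) * J0 (L / 2) (r 2) (((k 2 : ℕ) : ℤ) - 1)) (fun r v => by simp))
  · simp [kzT, tabT]
  · exact (Finset.sum_congr rfl fun r _ => by simp [kzT, tabT]; ring).trans
      (sum_eq_zero_of_factor 2 q (fun v => hh (L / 2) v (((k 2 : ℕ) : ℤ) - 1)) (hn _)
        (fun r => -(P0 (L / 2) (r 0) (((k 0 : ℕ) : ℤ) - 1) * P1 (L / 2) q (((k 1 : ℕ) : ℤ) - 1))) (fun r v => by simp))
  · simp [kzT, tabT]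
  · exact (Finset.sum_congr rfl fun r _ => by simp [kzT, tabT]; ring).trans
      (sum_eq_zero_of_factor 0 q (fun v => hh (L / 2) v (((k 0 : ℕ) : ℤ) - 1)) (hn _)
        (fun r => J0 (L / 2) (r 1) (((k 1 : ℕ) : ℤ) - 1) * J1 (L / 2) q (((k 2 : ℕ) : ℤ) - 1)) (fun r v => by simp))
  · exact (Finset.sum_congr rfl fun r _ => by simp [kzT, tabT]; ring).trans
      (sum_eq_zero_of_factor 1 q (fun v => hh (L / 2) v (((k 1 : ℕ) : ℤ) - 1)) (hn _)
        (fun r => P0 (L / 2) (r 0) (((k 0 : ℕ) : ℤ) - 1) * J1 (L / 2) q (((k 2 : ℕ) : ℤ) - 1)) (fun r v => by simp))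

/-- Hence **`SNeutral 1 (kzT L)`** (the exit slice). -/
theorem sNeutral_T (hodd : Odd L) : SNeutral (P := P3 L m K hL) 1 (kzT L) := sNeutral_of_sliceNeutral (sliceNeutral_T hodd)

end Neutral

end Summit.QuantumFields.YangMills.Theorems.ApproxLift.AnsatzT

end
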